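import Summits.CriticalPhenomena.PercolationContinuityZ3.Theorems.PercNearOneGluingNoHeavyLowerTailSahiAllButThreeRowA
import Summits.CriticalPhenomena.PercolationContinuityZ3.Theorems.PercNearOneGluingNoHeavyLowerTailSahiCTCSignatureType

/-!
# `NoHeavyLowerTail` (crux stmt-CriticalPhenomena-4575), Sahi / Kahn positivity: ROW (a) OF THE LEVEL-4 THRESHOLD CERTIFICATE
# FOR EVERY `k` — the Pólya certificate (A4Π) `Π·(Π·e₄ − Θ₃·D₄) ∈ ℕ[r]`

Support file (cell `prim-l12`, seat P3, gen 22; `--supports stmt-CriticalPhenomena-4575`).  No `sorry`, no named facts, standard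
axioms, no new definitions.  Memo `run/shared/lean/prim/prim-l12/FROM-prim-l12-p3-g22-*.md`.

Companion of `…SahiAllButThreeRowA` (level 3).  At level 4 the signature values `B₄(w, d)` of `X₄ = Π·e₄ − Θ₃·D₄` are negative at
THREE signatures (`B₄(8,0) = −23`, `B₄(9,0) = −4`, `B₄(6,1) = −2`), so no single injection works; instead the TYPE SUM
(`…SahiCTCSignatureType.coeff_PiP_mul_X_eq_typeSum`) `[n](Π·X₄) = Σ_b C(a₁,b)·g_{a₂,a₃}(b)` with inner sums
`g(b) = Σ_d C(a₂,d)·B₄(a₂ − d + b, a₃ + d)` is bounded below case by case: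

* `sigB_four_d0_nonneg` : `B₄(m, 0) ≥ 0` unless `m ∈ {8, 9}` (`C(m,4) ≥ 1 + m + C(m,2) + C(m,3)` for `m ≥ 10`); values `sigB_values`;
* `a₃ ≥ 2` : every signature has `≥ 2` doubled points and `B₄(w, e+2) = B₃(w, e+1) ≥ 0` (level shift `sigB_succ_succ`);
* `a₃ = 1` : `B₄(w, d+1) = B₃(w, d)` turns the type sum into the level-3 type sum of `n.erase t` (`t` the tripled point), which
  is `≥ 0` by (A3Π) `…SahiAllButThreeRowA.coeff_PiP_mul_X3_nonneg`;
* `a₃ = 0`, `a₂ ≥ 3` : every inner sum `g(b) ≥ 0` (`inner_nonneg_of_three_le`: `a₂ + b ≤ 9` by evaluation, else termwise);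
* `a₃ = 0`, `a₂ = 2, 1, 0` : `g` is `≥ 0` off one or two values of `b` (`inner_two_nonneg`, `inner_one_nonneg`, `sigB_four_d0_nonneg`)
  and the window terms reduce to the binomial inequalities `3C(a,6) ≤ 6C(a,5) + 47C(a,7)`,
  `17C(a,7) ≤ 12C(a,5) + 4C(a,6) + 15C(a,8) + 72C(a,9)`, `23C(a,8) + 4C(a,9) ≤ C(a,4) + 4C(a,5) + 8C(a,6) + 6C(a,7) + 34C(a,10) + 98C(a,11)`
  (`choose_ineq_two/one/zero`: small `a` by evaluation / one Pascal-ratio step each, large `a` by two ratio steps).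
Consequences: `coeff_PiP_mul_X4_nonneg` **(A4Π)**, `coeff_PiP_mul_aPoly4_nonneg`, `aRow4` (row (a)_4 at the odds of every interior
parameter vector on every `k`: `P(N ≤ 3)·P(N ≥ 5) ≤ P(N = 4)` for every Poisson-binomial `N`), `rhoCert_allButFour_of_N4`,
`sahiE_three_nonneg_of_allButFour_of_N4` (Kahn C5 / Sahi `C₃` for "at most four of `k` closed" from `Ñ₄ ≥ 0` alone).  By memo g21 §8
the multiplier `Π` is NOT enough at level 5 (`Π·X₅` has a negative coefficient at the squarefree type `(14,0,0)`).  Nothing is asserted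
about the crux.
-/

noncomputable section

open scoped Classical

namespace Summit.CriticalPhenomena.PercolationContinuityZ3.Theorems

namespace SahiAllButC

open Finset MvPolynomial
open SahiHittingSlot SahiTransportCert SahiAllButOne SahiAllButTwo SahiCTCForms SahiCTCGenFun SahiCTCWeightedLYM

/-! ### The values of `B₄` (and a few more of `B₃`) -/

/-- `B₄(8,0) = −23`. [this work] -/
theorem sigB_four_8_0 : sigB 4 8 0 = -23 := by decide

/-- `B₄(9,0) = −4`. [this work] -/
theorem sigB_four_9_0 : sigB 4 9 0 = -4 := by decide

/-- **`B₄(m, 0) ≥ 0` unless `m ∈ {8, 9}`** (`C(m,4) ≥ 1 + m + C(m,2) + C(m,3)` for `m ≥ 10`). [this work] -/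
theorem sigB_four_d0_nonneg {m : ℕ} (h8 : m ≠ 8) (h9 : m ≠ 9) : 0 ≤ sigB 4 m 0 := by
  rcases Nat.lt_or_ge m 10 with hm | hm
  · interval_cases m <;> first | decide | exact absurd rfl h8 | exact absurd rfl h9
  · obtain ⟨v, rfl⟩ : ∃ v, m = v + 10 := ⟨m - 10, by omega⟩
    have e4 : (v + 10).choose 4 * 4 = (v + 10).choose 3 * (v + 7) := by
      have := Nat.choose_succ_right_eq (v + 10) 3
      rw [show v + 10 - 3 = v + 7 by omega] at this; exact this
    have e3 : (v + 10).choose 3 * 3 = (v + 10).choose 2 * (v + 8) := by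
      have := Nat.choose_succ_right_eq (v + 10) 2
      rw [show v + 10 - 2 = v + 8 by omega] at this; exact this
    have e2 : (v + 10).choose 2 * 2 = (v + 10) * (v + 9) := by
      have := Nat.choose_succ_right_eq (v + 10) 1
      rw [Nat.choose_one_right, show v + 10 - 1 = v + 9 by omega] at this; exact this
    have i4 : (v + 10).choose 3 * 7 ≤ (v + 10).choose 4 * 4 := by rw [e4]; exact Nat.mul_le_mul_left _ (by omega)
    have i3 : (v + 10).choose 2 * 8 ≤ (v + 10).choose 3 * 3 := by rw [e3]; exact Nat.mul_le_mul_left _ (by omega)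
    have i2 : (v + 10) * 9 ≤ (v + 10).choose 2 * 2 := by rw [e2]; exact Nat.mul_le_mul_left _ (by omega)
    unfold sigB posN negN
    simp only [Finset.sum_range_succ, Finset.sum_range_zero, zero_add, Nat.choose_zero_right, Nat.choose_one_right,
      show (4 : ℕ) - 0 = 4 from rfl, if_pos (show 0 ≤ 4 from Nat.zero_le _)]
    split_ifs <;> omega

/-- `B₄(w, d + 1) = B₃(w, d)` (level shift) in the two forms used below. [this work] -/
theorem sigB_four_succ (w d : ℕ) : sigB 4 w (d + 1) = sigB 3 w d := sigB_succ_succ 3 w d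

/-- Every term of the inner sum at `a₂ = u + 3 ≥ 3` doubled points is `≥ 0` once `u + b ≥ 7` (all signatures have `w + d ≥ 10`
or `d ≥ 1` with `w ≠ 6`). [this work] -/
theorem inner_term_nonneg {a₂ b d : ℕ} (hd : d ≤ a₂) (hm : 10 ≤ a₂ + b) :
    0 ≤ (a₂.choose d : ℤ) * sigB 4 (a₂ - d + b) d := by
  refine mul_nonneg (Int.natCast_nonneg _) ?_
  rcases d with _ | _ | d
  · exact sigB_four_d0_nonneg (by omega) (by omega)
  · rw [sigB_four_succ]; exact sigB_three_nonneg (by omega)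
  · rw [sigB_four_succ]; exact sigB_three_nonneg (by omega)

/-- **The inner sum is `≥ 0` for `a₂ ≥ 3`**: `g(b) = Σ_d C(a₂,d)·B₄(a₂ − d + b, d) ≥ 0` (small `(a₂, b)` by evaluation, the rest
termwise). [this work] -/
theorem inner_nonneg_of_three_le {a₂ : ℕ} (ha : 3 ≤ a₂) (b : ℕ) :
    0 ≤ ∑ d ∈ range (a₂ + 1), (a₂.choose d : ℤ) * sigB 4 (a₂ - d + b) d := by
  by_cases hsmall : a₂ + b ≤ 9
  · have ha' : a₂ ≤ 9 := by omega
    have hb' : b ≤ 6 := by omega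
    interval_cases a₂ <;> interval_cases b <;> decide
  · exact sum_nonneg fun d hd => inner_term_nonneg (by rw [mem_range] at hd; omega) (by omega)

/-- More values: `B₄(4..7, 0) = 1, 4, 8, 6`, `B₄(10,0) = 34`, `B₄(11,0) = 98`, `B₃(8,0) = 19`, `B₃(9,0) = 38`, `B₃(6,1) = 8`,
`B₃(7,1) = 13`. [this work] -/
theorem sigB_values : sigB 4 4 0 = 1 ∧ sigB 4 5 0 = 4 ∧ sigB 4 6 0 = 8 ∧ sigB 4 7 0 = 6 ∧ sigB 4 10 0 = 34 ∧ sigB 4 11 0 = 98 ∧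
    sigB 3 8 0 = 19 ∧ sigB 3 9 0 = 38 ∧ sigB 3 6 1 = 8 ∧ sigB 3 7 1 = 13 := by decide

/-- `B₄(w, 1) = B₃(w, 0)` and `B₄(w, 2) = B₃(w, 1)`. [this work] -/
theorem sigB_four_one_two (w : ℕ) : sigB 4 w 1 = sigB 3 w 0 ∧ sigB 4 w 2 = sigB 3 w 1 :=
  ⟨sigB_succ_succ 3 w 0, sigB_succ_succ 3 w 1⟩

/-- The inner sum at `a₂ = 2` in closed form. [this work] -/
theorem inner_two_eq (b : ℕ) :
    ∑ d ∈ range (2 + 1), ((2 : ℕ).choose d : ℤ) * sigB 4 (2 - d + b) d = sigB 4 (b + 2) 0 + 2 * sigB 3 (b + 1) 0 + sigB 3 b 1 := by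
  simp only [Finset.sum_range_succ, Finset.sum_range_zero, zero_add, show (2 : ℕ) - 0 + b = b + 2 by omega,
    show (2 : ℕ) - 1 + b = b + 1 by omega, show (2 : ℕ) - 2 + b = b by omega, (sigB_four_one_two _).1, (sigB_four_one_two _).2,
    show ((2 : ℕ).choose 0 : ℤ) = 1 by decide, show ((2 : ℕ).choose 1 : ℤ) = 2 by decide, show ((2 : ℕ).choose 2 : ℤ) = 1 by decide]
  ring

/-- The inner sum at `a₂ = 2` is `≥ 0` for `b ≠ 6` (values `6, −3, 47` at `b = 5, 6, 7`). [this work] -/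
theorem inner_two_nonneg {b : ℕ} (hb : b ≠ 6) : 0 ≤ sigB 4 (b + 2) 0 + 2 * sigB 3 (b + 1) 0 + sigB 3 b 1 := by
  by_cases hsmall : b ≤ 7
  · interval_cases b <;> first | decide | exact absurd rfl hb
  · have h1 := sigB_four_d0_nonneg (m := b + 2) (by omega) (by omega)
    have h2 := sigB_three_nonneg (w := b + 1) (d := 0) (by omega)
    have h3 := sigB_three_nonneg (w := b) (d := 1) (by omega)
    linarith

/-- The inner sum at `a₂ = 1` in closed form. [this work] -/
theorem inner_one_eq (b : ℕ) :
    ∑ d ∈ range (1 + 1), ((1 : ℕ).choose d : ℤ) * sigB 4 (1 - d + b) d = sigB 4 (b + 1) 0 + sigB 3 b 0 := by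
  simp only [Finset.sum_range_succ, Finset.sum_range_zero, zero_add, show (1 : ℕ) - 0 + b = b + 1 by omega,
    show (1 : ℕ) - 1 + b = b by omega, (sigB_four_one_two _).1,
    show ((1 : ℕ).choose 0 : ℤ) = 1 by decide, show ((1 : ℕ).choose 1 : ℤ) = 1 by decide]
  ring

/-- The inner sum at `a₂ = 1` is `≥ 0` for `b ≠ 7` (values `12, 4, −17, 15, 72` at `b = 5, …, 9`). [this work] -/
theorem inner_one_nonneg {b : ℕ} (hb : b ≠ 7) : 0 ≤ sigB 4 (b + 1) 0 + sigB 3 b 0 := by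
  by_cases hsmall : b ≤ 8
  · interval_cases b <;> first | decide | exact absurd rfl hb
  · have h1 := sigB_four_d0_nonneg (m := b + 1) (by omega) (by omega)
    have h2 := sigB_three_nonneg (w := b) (d := 0) (by omega)
    linarith

/-- The inner sum at `a₂ = 0` is `B₄(b, 0)`. [this work] -/
theorem inner_zero (b : ℕ) : ∑ d ∈ range (0 + 1), ((0 : ℕ).choose d : ℤ) * sigB 4 (0 - d + b) d = sigB 4 b 0 := by
  rw [zero_add, Finset.sum_range_one]; simp

/-! ### The three binomial inequalities in `a₁` -/

/-- `a₂ = 2`: `3·C(a,6) ≤ 6·C(a,5) + 47·C(a,7)` (`a ≤ 17` / `a ≥ 18`). [this work] -/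
theorem choose_ineq_two (a : ℕ) : 3 * a.choose 6 ≤ 6 * a.choose 5 + 47 * a.choose 7 := by
  rcases Nat.lt_or_ge a 6 with h | h
  · rw [Nat.choose_eq_zero_of_lt h]; omega
  · obtain ⟨b, rfl⟩ : ∃ b, a = b + 6 := ⟨a - 6, by omega⟩
    have h1 : (b + 6).choose 6 * 6 = (b + 6).choose 5 * (b + 1) := by
      have := Nat.choose_succ_right_eq (b + 6) 5
      rw [show b + 6 - 5 = b + 1 by omega] at this; exact this
    have h2 : (b + 6).choose 7 * 7 = (b + 6).choose 6 * b := by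
      have := Nat.choose_succ_right_eq (b + 6) 6
      rw [show b + 6 - 6 = b by omega] at this; exact this
    rcases Nat.lt_or_ge b 12 with hb | hb
    · have : (b + 6).choose 6 * 6 ≤ (b + 6).choose 5 * 12 := by rw [h1]; exact Nat.mul_le_mul_left _ (by omega)
      omega
    · have : (b + 6).choose 6 * 12 ≤ (b + 6).choose 7 * 7 := by rw [h2]; exact Nat.mul_le_mul_left _ hb
      omega

/-- `a₂ = 1`: `17·C(a,7) ≤ 12·C(a,5) + 4·C(a,6) + 15·C(a,8) + 72·C(a,9)` (`a ≤ 11` / `a ≥ 12`). [this work] -/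
theorem choose_ineq_one (a : ℕ) : 17 * a.choose 7 ≤ 12 * a.choose 5 + 4 * a.choose 6 + 15 * a.choose 8 + 72 * a.choose 9 := by
  rcases Nat.lt_or_ge a 7 with h | h
  · rw [Nat.choose_eq_zero_of_lt h]; omega
  · obtain ⟨b, rfl⟩ : ∃ b, a = b + 7 := ⟨a - 7, by omega⟩
    have h6 : (b + 7).choose 6 * 6 = (b + 7).choose 5 * (b + 2) := by
      have := Nat.choose_succ_right_eq (b + 7) 5
      rw [show b + 7 - 5 = b + 2 by omega] at this; exact this
    have h7 : (b + 7).choose 7 * 7 = (b + 7).choose 6 * (b + 1) := by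
      have := Nat.choose_succ_right_eq (b + 7) 6
      rw [show b + 7 - 6 = b + 1 by omega] at this; exact this
    have h8 : (b + 7).choose 8 * 8 = (b + 7).choose 7 * b := by
      have := Nat.choose_succ_right_eq (b + 7) 7
      rw [show b + 7 - 7 = b by omega] at this; exact this
    have h9 : (b + 7).choose 9 * 9 = (b + 7).choose 8 * (b - 1) := by
      have := Nat.choose_succ_right_eq (b + 7) 8
      rw [show b + 7 - 8 = b - 1 by omega] at this; exact this
    rcases Nat.lt_or_ge b 5 with hb | hb
    · -- `a ≤ 11`: `7·C7 ≤ 5·C6`, `C6 ≤ C5`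
      have i7 : (b + 7).choose 7 * 7 ≤ (b + 7).choose 6 * 5 := by rw [h7]; exact Nat.mul_le_mul_left _ (by omega)
      have i6 : (b + 7).choose 6 * 6 ≤ (b + 7).choose 5 * 6 := by rw [h6]; exact Nat.mul_le_mul_left _ (by omega)
      omega
    · -- `a ≥ 12`: `8·C8 ≥ 5·C7`, `9·C9 ≥ 4·C8`
      have i8 : (b + 7).choose 7 * 5 ≤ (b + 7).choose 8 * 8 := by rw [h8]; exact Nat.mul_le_mul_left _ hb
      have i9 : (b + 7).choose 8 * 4 ≤ (b + 7).choose 9 * 9 := by rw [h9]; exact Nat.mul_le_mul_left _ (by omega)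
      omega

/-- `a₂ = 0`: `P(a) = C(a,4) + 4C(a,5) + 8C(a,6) + 6C(a,7) − 23C(a,8) − 4C(a,9) + 34C(a,10) + 98C(a,11) ≥ 0` (`a ≤ 16` by
evaluation; `a ≥ 17`: `34·C(a,10) ≥ 23·C(a,8) + 4·C(a,9)`). [this work] -/
theorem choose_ineq_zero (a : ℕ) : 23 * a.choose 8 + 4 * a.choose 9 ≤
    a.choose 4 + 4 * a.choose 5 + 8 * a.choose 6 + 6 * a.choose 7 + 34 * a.choose 10 + 98 * a.choose 11 := by
  rcases Nat.lt_or_ge a 17 with h | h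
  · interval_cases a <;> decide
  · obtain ⟨b, rfl⟩ : ∃ b, a = b + 17 := ⟨a - 17, by omega⟩
    have h9 : (b + 17).choose 9 * 9 = (b + 17).choose 8 * (b + 9) := by
      have := Nat.choose_succ_right_eq (b + 17) 8
      rw [show b + 17 - 8 = b + 9 by omega] at this; exact this
    have h10 : (b + 17).choose 10 * 10 = (b + 17).choose 9 * (b + 8) := by
      have := Nat.choose_succ_right_eq (b + 17) 9
      rw [show b + 17 - 9 = b + 8 by omega] at this; exact this
    have i9 : (b + 17).choose 8 * 9 ≤ (b + 17).choose 9 * 9 := by rw [h9]; exact Nat.mul_le_mul_left _ (by omega)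
    have i10 : (b + 17).choose 9 * 8 ≤ (b + 17).choose 10 * 10 := by rw [h10]; exact Nat.mul_le_mul_left _ (by omega)
    omega

/-! ### The main theorem at level 4 -/

section Main4

variable {α : Type*} [DecidableEq α] [Fintype α]

/-- A window of a `range` sum of a function vanishing beyond the range and nonnegative off the window is a lower bound.
[folklore] -/
theorem sum_Ico_le_sum_range {F : ℕ → ℤ} {a lo hi : ℕ} (hz : ∀ b, a < b → F b = 0)
    (hnn : ∀ b, b < lo ∨ hi ≤ b → 0 ≤ F b) :
    ∑ b ∈ Ico lo hi, F b ≤ ∑ b ∈ range (a + 1), F b := by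
  rw [sum_range_eq_of_vanish_int (b := max (a + 1) hi) (fun i hi => hz i (by omega))
    (fun i hi => hz i (by omega))]
  refine sum_le_sum_of_subset_of_nonneg (fun b hb => ?_) fun b _ hb => hnn b ?_
  · rw [mem_Ico] at hb; rw [mem_range]; omega
  · rw [mem_Ico] at hb; omega

omit [Fintype α] in
/-- Levels `{i : n i = j}` are unchanged by erasing a point `t` with `n t ≠ j`. [this work] -/
theorem filter_erase_of_ne {n : α →₀ ℕ} {t : α} {j : ℕ} (ht : n t ≠ j) :
    ((Finsupp.erase t n).support.filter fun i => (Finsupp.erase t n) i = j) = n.support.filter fun i => n i = j := by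
  ext i
  simp only [mem_filter, Finsupp.mem_support_iff]
  by_cases hit : i = t
  · subst hit; rw [Finsupp.erase_same]; constructor
    · rintro ⟨h, -⟩; exact absurd rfl h
    · rintro ⟨-, h⟩; exact absurd h ht
  · rw [Finsupp.erase_ne hit]

/-- **(A4Π): `Π·(Π·e₄ − Θ₃·D₄) ∈ ℕ[r]` on every finite ground type** — the Pólya certificate for row (a) of the level-4
threshold certificate.  By the type sum: profiles with an entry `≥ 4` give `0`; with `≥ 2` tripled points every signature has
`d ≥ 2` (termwise `≥ 0`); with one tripled point `t` the level shift `B₄(w, d+1) = B₃(w, d)` turns the sum into the level-3 sum of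
`n.erase t` (`≥ 0` by (A3Π)); with none, `Σ_b C(a₁,b)·g_{a₂}(b)` with `g ≥ 0` for `a₂ ≥ 3` and the three binomial inequalities
for `a₂ = 2, 1, 0`. [this work] -/
theorem coeff_PiP_mul_X4_nonneg (n : α →₀ ℕ) : 0 ≤ (PiP * (PiP * ee 4 - ThC 3 * DdC 4) : MvPolynomial α ℤ).coeff n := by
  by_cases h4 : ∃ t, 4 ≤ n t
  · obtain ⟨t, ht⟩ := h4
    have h0 := coeff_PiP_mul_X_eq_zero (α := α) 3 ht
    simp only [show (3 : ℕ) + 1 = 4 from rfl] at h0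
    rw [h0]
  push Not at h4
  have hn : ∀ i, n i ≤ 3 := fun i => by have := h4 i; omega
  have key := coeff_PiP_mul_X_eq_typeSum (α := α) 3 hn
  simp only [show (3 : ℕ) + 1 = 4 from rfl] at key
  rw [key]; clear key
  rcases Nat.lt_or_ge #(n.support.filter fun i => n i = 3) 2 with ha3 | ha3
  · rcases Nat.lt_or_ge #(n.support.filter fun i => n i = 3) 1 with ha3' | ha3'
    · -- no tripled point: `Σ_b C(a₁,b)·g(b)`
      have h30 : #(n.support.filter fun i => n i = 3) = 0 := by omega
      rw [h30]
      simp only [zero_add]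
      generalize #(n.support.filter fun i => n i = 1) = a₁
      generalize #(dbl n) = a₂
      simp_rw [mul_assoc, ← mul_sum]
      rcases Nat.lt_or_ge a₂ 3 with ha2 | ha2
      · have hz : ∀ G : ℕ → ℤ, ∀ b, a₁ < b → (a₁.choose b : ℤ) * G b = 0 := fun G b hb => by
          rw [Nat.choose_eq_zero_of_lt hb]; simp
        interval_cases a₂
        · -- `a₂ = 0`
          simp_rw [inner_zero]
          refine le_trans ?_ (sum_Ico_le_sum_range (lo := 4) (hi := 12) (hz _) fun b hb =>
            mul_nonneg (Int.natCast_nonneg _) (sigB_four_d0_nonneg (by omega) (by omega)))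
          rw [Finset.sum_Ico_eq_sum_range]
          obtain ⟨v4, v5, v6, v7, v10, v11, -, -, -, -⟩ := sigB_values
          simp only [Finset.sum_range_succ, Finset.sum_range_zero, zero_add, show 4 + 0 = 4 from rfl, show 4 + 1 = 5 from rfl,
            show 4 + 2 = 6 from rfl, show 4 + 3 = 7 from rfl, show 4 + 4 = 8 from rfl, show 4 + 5 = 9 from rfl,
            show 4 + 6 = 10 from rfl, show 4 + 7 = 11 from rfl, v4, v5, v6, v7, v10, v11, sigB_four_8_0, sigB_four_9_0]
          have hc : (23 * a₁.choose 8 + 4 * a₁.choose 9 : ℤ) ≤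
              a₁.choose 4 + 4 * a₁.choose 5 + 8 * a₁.choose 6 + 6 * a₁.choose 7 + 34 * a₁.choose 10 + 98 * a₁.choose 11 := by
            exact_mod_cast choose_ineq_zero a₁
          linarith
        · -- `a₂ = 1`
          simp_rw [inner_one_eq]
          refine le_trans ?_ (sum_Ico_le_sum_range (lo := 5) (hi := 10) (hz _) fun b hb =>
            mul_nonneg (Int.natCast_nonneg _) (inner_one_nonneg (by omega)))
          rw [Finset.sum_Ico_eq_sum_range]
          obtain ⟨-, -, v6, v7, v10, -, v8', v9', -, -⟩ := sigB_values
          simp only [Finset.sum_range_succ, Finset.sum_range_zero, zero_add, show 5 + 0 = 5 from rfl, show 5 + 1 = 6 from rfl,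
            show 5 + 2 = 7 from rfl, show 5 + 3 = 8 from rfl, show 5 + 4 = 9 from rfl, show 9 + 1 = 10 from rfl, v6, v7, v10,
            v8', v9',
            sigB_four_8_0, sigB_four_9_0, sigB_three_5_0, sigB_three_6_0, sigB_three_7_0]
          have hc : (17 * a₁.choose 7 : ℤ) ≤ 12 * a₁.choose 5 + 4 * a₁.choose 6 + 15 * a₁.choose 8 + 72 * a₁.choose 9 := by
            exact_mod_cast choose_ineq_one a₁
          linarith
        · -- `a₂ = 2`
          simp_rw [inner_two_eq]
          refine le_trans ?_ (sum_Ico_le_sum_range (lo := 5) (hi := 8) (hz _) fun b hb =>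
            mul_nonneg (Int.natCast_nonneg _) (inner_two_nonneg (by omega)))
          rw [Finset.sum_Ico_eq_sum_range]
          obtain ⟨-, -, -, v7, -, -, v8', -, v61, v71⟩ := sigB_values
          simp only [Finset.sum_range_succ, Finset.sum_range_zero, zero_add, show 5 + 0 = 5 from rfl, show 5 + 1 = 6 from rfl,
            show 5 + 2 = 7 from rfl, show 7 + 1 = 8 from rfl, show 7 + 2 = 9 from rfl, v7, v8', v61, v71, sigB_four_8_0, sigB_four_9_0, sigB_three_5_1, sigB_three_6_0,
            sigB_three_7_0]
          have hc : (3 * a₁.choose 6 : ℤ) ≤ 6 * a₁.choose 5 + 47 * a₁.choose 7 := by exact_mod_cast choose_ineq_two a₁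
          linarith
      · -- `a₂ ≥ 3`: every inner sum is `≥ 0`
        exact sum_nonneg fun b _ => mul_nonneg (Int.natCast_nonneg _) (inner_nonneg_of_three_le ha2 b)
    · -- exactly one tripled point `t`: level shift to `(A3Π)` at `n.erase t`
      have h31 : #(n.support.filter fun i => n i = 3) = 1 := by omega
      obtain ⟨t, ht⟩ := card_eq_one.1 h31
      have ht3 : n t = 3 := by
        have : t ∈ n.support.filter fun i => n i = 3 := by rw [ht]; exact mem_singleton_self t
        exact (mem_filter.1 this).2
      set n' := Finsupp.erase t n with hn'
      have hn'3 : ∀ i, n' i ≤ 3 := fun i => by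
        by_cases hit : i = t
        · rw [hit, hn', Finsupp.erase_same]; exact Nat.zero_le _
        · rw [hn', Finsupp.erase_ne hit]; exact hn i
      have hV1 : (n'.support.filter fun i => n' i = 1) = n.support.filter fun i => n i = 1 :=
        filter_erase_of_ne (by omega)
      have hV2 : dbl n' = dbl n := filter_erase_of_ne (by omega)
      have hV3 : (n'.support.filter fun i => n' i = 3) = ∅ := by
        refine filter_eq_empty_iff.2 fun i hi h => ?_
        by_cases hit : i = t
        · rw [hit, hn', Finsupp.erase_same] at h; exact absurd h (by norm_num)
        · rw [hn', Finsupp.erase_ne hit] at h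
          have : i ∈ ({t} : Finset α) := ht ▸ mem_filter.2 ⟨Finsupp.mem_support_iff.2 (by omega), h⟩
          exact hit (mem_singleton.1 this)
      have h3 := coeff_PiP_mul_X3_nonneg n'
      have key3 := coeff_PiP_mul_X_eq_typeSum (α := α) 2 hn'3
      simp only [show (2 : ℕ) + 1 = 3 from rfl] at key3
      rw [key3, hV1, hV2, hV3, card_empty] at h3
      rw [h31]
      have hshift : ∀ x d : ℕ, sigB 4 x (1 + d) = sigB 3 x (0 + d) := fun x d => by
        rw [add_comm 1 d, zero_add]; exact sigB_succ_succ 3 x d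
      simp_rw [hshift]
      exact h3
  · -- at least two tripled points: every signature has `≥ 2` doubled points
    refine sum_nonneg fun b _ => sum_nonneg fun d _ => mul_nonneg (mul_nonneg (Int.natCast_nonneg _) (Int.natCast_nonneg _)) ?_
    obtain ⟨e, he⟩ : ∃ e, #(n.support.filter fun i => n i = 3) + d = e + 1 + 1 := ⟨#(n.support.filter fun i => n i = 3) + d - 2, by omega⟩
    rw [he, sigB_four_succ]
    exact sigB_three_nonneg (by omega)

end Main4

/-! ### Row (a) of the level-4 certificate for every `k`, and the certificate with (a) discharged -/

section RowA4

open Literature.Combinatorics.Sahi2008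
open Literature.Probability.Percolation (DeterminedBy)

variable {k : ℕ}

/-- **(A4Π) in the shape of `…SahiAllButCPolya`**: `Π·((Π + D₄)·e₄ − Θ₄·D₄) ∈ ℕ[r]` on every finite ground type. [this work] -/
theorem coeff_PiP_mul_aPoly4_nonneg {α : Type*} [DecidableEq α] [Fintype α] (n : α →₀ ℕ) :
    0 ≤ (PiP * ((PiP + DdC 4) * ee 4 - ThC 4 * DdC 4) : MvPolynomial α ℤ).coeff n := by
  have h := aPolyC_eq (α := α) 3
  norm_num at h
  rw [h]
  exact coeff_PiP_mul_X4_nonneg n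

/-- **Row (a) of the level-4 threshold certificate at the odds vector of interior parameters, EVERY `k`**:
`Θ₄(r)·D₄(r) ≤ (Π(r) + D₄(r))·e₄(r)`, i.e. `P(N ≤ 3)·P(N ≥ 5) ≤ P(N = 4)` for every Poisson-binomial `N`. [this work] -/
theorem aRow4 {q : Fin k → unitInterval} (hq : ∀ i, 0 < (q i : ℝ) ∧ (q i : ℝ) < 1) :
    ev q (ThC 4) * ev q (DdC 4) ≤ (ev q PiP + ev q (DdC 4)) * ev q (ee 4 : MvPolynomial (Fin k) ℤ) :=
  aRowC_of_coeff_PiP_mul_nonneg (fun n => coeff_PiP_mul_aPoly4_nonneg n) hq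

/-- **THE LEVEL-4 THRESHOLD CERTIFICATE, (a) discharged.**  For `k ≥ 4` and interior parameters: if `Ñ₄(K_𝒳,K_𝒵)(r) ≥ 0` for
all nonempty up-sets `𝒳, 𝒵`, then `ρ₄ = μ(· | exactly four closed)` is a reduced transport certificate of `allBut 4 k = Th_{k−4}^k`.
[this work] -/
theorem rhoCert_allButFour_of_N4 {q : Fin k → unitInterval} (hq : ∀ i, 0 < (q i : ℝ) ∧ (q i : ℝ) < 1) (hk : 4 ≤ k)
    (hN : ∀ 𝒳 𝒵 : Set (Set (Fin k)), IsUpperSet 𝒳 → IsUpperSet 𝒵 → 𝒳.Nonempty → 𝒵.Nonempty → 0 ≤ ev q (Ngen 4 (cx 𝒳) (cx 𝒵))) :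
    RhoCert q (allBut 4 k) (rhoC q 4) :=
  rhoCert_allBut hq hk (aRow4 hq) hN

/-- **KAHN'S CONJECTURE 5 / SAHI'S `C₃` FOR THE LEVEL-4 THRESHOLD FIRST SLOT ("AT LEAST `k − 4` OF `k` OPEN") ON `k` COORDINATES,
CONDITIONAL ONLY ON `Ñ₄ ≥ 0` AT THE ODDS.**  For a block `e : Fin k ↪ ι` (`k ≥ 4`) with interior parameters, an increasing event
`H` determined by the block with pattern event `allBut 4 k` (at most four of the `k` coordinates closed), the (TC) hypothesis
`Ñ₄(K_𝒳,K_𝒵)(r) ≥ 0` for all nonempty up-sets of patterns, and ALL increasing `U, V`: `E₃(1_H, 1_U, 1_V) ≥ 0`. [this work] -/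
theorem sahiE_three_nonneg_of_allButFour_of_N4 {ι : Type} [Fintype ι] (p : ι → unitInterval) (e : Fin k ↪ ι) (hk : 4 ≤ k)
    (hp : ∀ i, 0 < (p (e i) : ℝ) ∧ (p (e i) : ℝ) < 1)
    (hN : ∀ 𝒳 𝒵 : Set (Set (Fin k)), IsUpperSet 𝒳 → IsUpperSet 𝒵 → 𝒳.Nonempty → 𝒵.Nonempty →
      0 ≤ ev (pk e p) (Ngen 4 (cx 𝒳) (cx 𝒵)))
    {H : Set (Set ι)} (hH : DeterminedBy H (Set.range e)) (hpat : pat e H = allBut 4 k) {U V : Set (Set ι)}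
    (hU : IsUpperSet U) (hV : IsUpperSet V) :
    0 ≤ sahiE (bernoulliWeight p) 3
      ![Literature.Probability.Percolation.DecisionTree.ind H, Literature.Probability.Percolation.DecisionTree.ind U,
        Literature.Probability.Percolation.DecisionTree.ind V] :=
  sahiE_three_nonneg_of_allBut_of_polya p e hk hp (fun n => coeff_PiP_mul_aPoly4_nonneg n) hN hH hpat hU hV

end RowA4

end SahiAllButC

end Summit.CriticalPhenomena.PercolationContinuityZ3.Theorems
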